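/-
Copyright (c) 2026 the pub-hodgecm-mathlib formalisation cell (harness21).  Prover seat hodgecm-mathlib-K2E3-p06 (g4), Track B «K2-LIT», engine E3, unit U4 «Keys»; deal (D59)
(dealer K2E3-plan (g3) 04:48:08Z), census `K2/K2E3-p06/g4/CENSUS-U4f-PosLevel.K2E3-p06-g4.md` §0 (I) ∕ (E1); 2026-09-04.
KERNEL module: THEOREMS ONLY (no definition, no named fact, no `sorry`, no instance, no notation).
-/
import Summits.HodgeConjecture.HodgeConjecture.Theorems.K2E3KeysThmTwoContractingRamified        -- ★ p857330 (this seat): `keysThmTwoContracting_of_unramified_nonsplit` (U4-f + `hU` at every non-split place)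
import Summits.HodgeConjecture.HodgeConjecture.Theorems.K2E3KeysThmTwoUnramifiedLineReduction    -- ★ (K2E3-p04 (g3)): `cmTorusCharPair_one_eq_one_of_unramified`; brings ★ p857080 `K2E3PrincipalSeriesDetTwist.reducible_iff_reducible_one`
import HarnessLib

/-!
# K2 ∕ E3 «EllipticInputs», unit U4 «Keys» — KEYS' THEOREM §7 (2) («Re s > 0» form) FOR EVERY UNRAMIFIED `χ₁` AND EVERY `χ₂`, AT EVERY NON-SPLIT PLACE:
# the `χ₂`-coordinate of U4-f is idle (twist by `χ₂⁻¹ ∘ det`)   [Keys1984 §7 Thm (2)(a); Rogawski1990 §12.1–§12.2; BernsteinZelevinsky1977 §2.3]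

Cell hodgecm-mathlib (D-0151), FLOOR 0, Track B «K2-LIT», engine E3, crux item H413 = stmt-HodgeConjecture-24833 (route `HCCMUnconditional`, no route verbs); target BY NAME
`…K2E3EllipticInputs.U4Keys.sig_K2E3KeysThmTwoContracting` (U4-f, U4Keys ED. 5 :89, REL over (U4f-ram-χ) `sig_K2E3KeysThmTwoContractingPosLevel` :124).  Author K2E3-p06 (g4).
`--supports stmt-HodgeConjecture-24833 --as helper`; THEOREMS ONLY.  NOT THE PAYER of (U4f-ram-χ): it closes the half «`χ₁` unramified, `χ₂` arbitrary» of that leaf.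

THE POINT.  The hosted leaf (U4f-ram-χ) = U4-f + `¬ hU` with `hU` = «`χ = (χ₁, χ₂)` trivial on `T ∩ K_v`», and `hU ⟺ (χ₁ = 1 on 𝒪_vˣ) ∧ (χ₂ = 1)` (★ `eq_one_of_levelTrivial`, ★
`cmTorusCharPair_one_eq_one_of_unramified`).  So `¬ hU` mixes two cases: (I) `χ₁` UNRAMIFIED with `χ₂ ≠ 1`, and (II) `χ₁` RAMIFIED.  Case (I) is not a conductor-≥-1 problem at all:
`i_G(χ₁, χ₂) ⊗ (χ₂⁻¹ ∘ det_G) ≅ i_G(χ₁, 1)` (★ p857080 `reducible_iff_reducible_one`, K2E3-p04 (g3)), `(χ₁, 1)` IS trivial on `T ∩ K_v` when `χ₁` is unramified (★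
`cmTorusCharPair_one_eq_one_of_unramified`), and U4-f's conclusion mentions `χ₁` only — so ★ p857330 `keysThmTwoContracting_of_unramified_nonsplit` applied to `(χ₁, 1)` settles it.
* §1 **`keysThmTwoContracting_of_unramifiedChar`** — U4-f's binder text VERBATIM plus the single hypothesis `hunr : χ₁ = 1` on `𝒪_vˣ = (Π_w 𝒪_w)ˣ` (the ★ currency of
  `…UnramifiedLineReduction` ∕ `…SphericalCFunctionUnramifiedHypotheses`), inserted before `hred`: a reducible `i_G(χ₁, χ₂)` with `χ₁` non-unitary contracting and UNRAMIFIED has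
  `χ₁ = ‖·‖_E` or `χ₁ = η‖·‖_E^{1∕2}` with `η|_{F^×} = ω_{E∕F}` — for EVERY continuous `χ₂`, at EVERY non-split place (inert, tame, wild).
After this file the residue of U4-f is EXACTLY «`χ₁` RAMIFIED» (conductor of `χ₁` ≥ 1): Road I proper — the composition scalar `J(w₀⁻¹,w₀χ)∘J(w₀,χ) = γ(χ)·id` as a Tate γ-factor and its zero
set off the unitary axis [Keys1984 §5, §7 (2)(b)–(d)]; no road in the tree (census (M1)–(M4)).
HONEST LABEL: HC_CM is proved only modulo the 7 printed citations (2 remaining named inputs: hLiu418 = stmt-HodgeConjecture-24832, h413 = stmt-HodgeConjecture-24833)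
until rung 0 closes; count-neutral — this file does NOT pay U4-f or (U4f-ram-χ); no printed citation is discharged.

## References
* [Keys1984] D. Keys, *Principal series representations of special unitary groups over local fields*, Compositio Math. 51 (1984), §7 Theorem (2) p. 126.
* [Rogawski1990] J. D. Rogawski, *Automorphic Representations of Unitary Groups in Three Variables*, Ann. of Math. Stud. 123 (1990), §12.1 p. 171, §12.2 (1)–(2) p. 173.
* [BernsteinZelevinsky1977] I. N. Bernstein, A. V. Zelevinsky, Ann. Sci. ÉNS 10 (1977), §2.3 (twisting induced representations by a character of `G`), Thm. 2.9.
* [BushnellHenniart2006] C. J. Bushnell, G. Henniart, *The local Langlands conjecture for GL(2)*, Grundlehren 335 (2006), §9.1 (`Ind χ ⊗ (φ∘det) ≅ Ind (χ·φ)`).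
-/

set_option autoImplicit false
-- the mandated namespace has the single-problem summit's repeated segment (`HodgeConjecture.HodgeConjecture`)
set_option linter.dupNamespace false

noncomputable section

open NumberField IsDedekindDomain MeasureTheory
open scoped Matrix MatrixGroups NNReal WithZero Valued
open Literature.NumberTheory Literature.NumberTheory.Automorphic Literature.NumberTheory.Automorphic.UnitaryGroup
open Literature.NumberTheory.Rogawski1990 Literature.NumberTheory.GaloisRepresentations

namespace Summit.HodgeConjecture.HodgeConjecture.Cruxes.H413.K2E3KeysThmTwoContractingUnramifiedChar

open Summit.HodgeConjecture.HodgeConjecture.Cruxes.H413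

variable (L : Type) [Field L] [NumberField L] [IsCMField L] (v : HeightOneSpectrum (𝓞 ↥(maximalRealSubfield L)))

/-! ## §1 U4-f for an unramified `χ₁` and every `χ₂`, at every non-split place -/

set_option maxHeartbeats 6400000 in
set_option synthInstance.maxHeartbeats 400000 in
-- statement-level `whnf` on the CM carriers (class of ★ p857330 §3 ∕ ★ p856959)
/-- **KEYS' THEOREM §7 (2) («Re s > 0» FORM) FOR EVERY UNRAMIFIED `χ₁` AND EVERY CONTINUOUS `χ₂`, AT EVERY NON-SPLIT PLACE (inert, tamely or wildly ramified): U4-f's binder text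
VERBATIM plus the single hypothesis `hunr` (`χ₁ = 1` on `𝒪_vˣ = (Π_w 𝒪_w)ˣ`).**  A reducible `i_G(χ₁, χ₂)` with `χ₁` non-unitary contracting has `χ₁ = ‖·‖_E` (★ `halfModulusChar²`) or
`χ₁ = η‖·‖_E^{1∕2}` with `η` quadratic of extension type and continuous.  Proof: `i_G(χ₁, χ₂)` reducible ⟺ `i_G(χ₁, 1)` reducible (★ p857080 `reducible_iff_reducible_one`, the twist by
`χ₂⁻¹ ∘ det_G`); `(χ₁, 1)` is trivial on `T ∩ K_v` (★ `cmTorusCharPair_one_eq_one_of_unramified`); ★ p857330 `keysThmTwoContracting_of_unramified_nonsplit` for `(χ₁, 1)` (inert ★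
p856959 ∨ the h2-free ramified rung over Road II ★ p857260), whose conclusion is about `χ₁` alone.
[cite: Keys1984, §7 Theorem (2) (a) p. 126] [cite: Rogawski1990, §12.1 p. 171, §12.2 (1)–(2) p. 173] [cite: BernsteinZelevinsky1977, §2.3] [cite: BushnellHenniart2006, §9.1] -/
theorem keysThmTwoContracting_of_unramifiedChar
    (hns : ∀ w : PlacesOver L v, IsCMField.complexConj L • w.1 = w.1)
    (χ₁ : (UnitaryGroup.LocalRing L v)ˣ →* ℂˣ) (χ₂ : ↥(normOneUnits (conjLocal L (IsCMField.complexConj L) v)) →* ℂˣ)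
    (h₁ : Continuous (fun x => ((χ₁ x : ℂˣ) : ℂ))) (h₂ : Continuous (fun x => ((χ₂ x : ℂˣ) : ℂ))) (hnu : ∃ x, ‖((χ₁ x : ℂˣ) : ℂ)‖ ≠ 1)
    (hcontr : ∀ x : (UnitaryGroup.LocalRing L v)ˣ, unitModulusChar (UnitaryGroup.LocalRing L v) x < 1 → ‖((χ₁ x : ℂˣ) : ℂ)‖ < 1)
    (hunr : ∀ u ∈ (Submonoid.pi Set.univ (fun w : PlacesOver L v => (w.1.adicCompletionIntegers L).toSubring.toSubmonoid)).units, χ₁ u = 1)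
    (hred : ∃ N : Subrepresentation (UnitaryGroup.cmPrincipalSeries L 3 v (UnitaryGroup.cmTorusCharPair L v χ₁ χ₂)), N ≠ ⊥ ∧ N ≠ ⊤) :
    χ₁ = halfModulusChar (UnitaryGroup.LocalRing L v) * halfModulusChar (UnitaryGroup.LocalRing L v) ∨
      (∃ η : (UnitaryGroup.LocalRing L v)ˣ →* ℂˣ, IsQuadraticCharExtension (conjLocal L (IsCMField.complexConj L) v) η ∧
        Continuous (fun x => ((η x : ℂˣ) : ℂ)) ∧ χ₁ = η * halfModulusChar (UnitaryGroup.LocalRing L v)) := by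
  -- drop `χ₂`: twist by `χ₂⁻¹ ∘ det`
  have hred₁ : ∃ N : Subrepresentation (UnitaryGroup.cmPrincipalSeries L 3 v (UnitaryGroup.cmTorusCharPair L v χ₁ 1)), N ≠ ⊥ ∧ N ≠ ⊤ :=
    (K2E3PrincipalSeriesDetTwist.reducible_iff_reducible_one L v χ₁ χ₂ h₂).1 hred
  -- `(χ₁, 1)` is trivial on `T ∩ K_v`
  have hU₁ : ∀ t : ↥(torusU (conjLocal L (IsCMField.complexConj L) v) (cmLocalForm L 3 v)),
      (t : ↥(unitaryGroupOfForm (conjLocal L (IsCMField.complexConj L) v) (cmLocalForm L 3 v))) ∈ cmLocalIntegralLevel L 3 (qsForm L) v →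
        cmTorusCharPair L v χ₁ 1 t = 1 :=
    K2E3KeysThmTwoUnramifiedLineReduction.cmTorusCharPair_one_eq_one_of_unramified L v hns χ₁ hunr
  -- the trivial character of `E¹_v` is continuous
  have h₂' : Continuous (fun x : ↥(normOneUnits (conjLocal L (IsCMField.complexConj L) v)) => (((1 : ↥(normOneUnits (conjLocal L (IsCMField.complexConj L) v)) →* ℂˣ) x : ℂˣ) : ℂ)) := by
    simp only [MonoidHom.one_apply, Units.val_one]
    exact continuous_const
  exact K2E3KeysThmTwoContractingRamified.keysThmTwoContracting_of_unramified_nonsplit L v hns χ₁ 1 h₁ h₂' hnu hcontr hU₁ hred₁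

end Summit.HodgeConjecture.HodgeConjecture.Cruxes.H413.K2E3KeysThmTwoContractingUnramifiedChar

end
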